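import Mathlib

/-!
# Hodge-locus census — THEOREM J2∞ bookkeeping: the ORDERINGS of the ARITHMETIC LEMMA (b) for all `k′ ≥ 4`, `d ≥ 4`

certified instances and evidence bearing on the general Hodge conjecture; no claim.

pub-hlocus ENGINE B (seat ivhs-2), gen 33, record `pub-hlocus-ivhs-2/ENGINEB-g33.md` §4d (def-free, notation-free helper of
`stmt-HodgeConjecture-16267`; companion of `HodgeLocusCensusJumpStratum.lean`, `…JumpFlag.lean`, `…JumpFamilies.lean`, `…JumpArithmetic.lean`).

Setting (record §4b/§4d; notation of `…JumpArithmetic.lean`): codimensions of the pieces relative to `E`,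
  `Σ° : 1`, `TOP : C(k′+d-3, d-2) - E`, `P : BASE_Q(k′-1) + k′`, `P′ : BASE_G(k′-1) + 1`, `Q_r : BASE_Q(m) + 1`, `G_r : BASE_G(m) + 1` (`+2` for `G_2` at `d = 4`),
  `m = k′ - r`, `BASE_Q(m) = m² + C(m+1,2) - C(m+d-1,d)`, `BASE_G(m) = m² + C(m+d-3,d-2) - C(m+d-1,d)`, `E+1 = C(k′+d-1,d) - C(k′+1,2) - k′² + 1`.
The maximality argument of §4d uses the ORDERINGS (b): (i) `TOP` has the least codimension among admissible pieces; (ii) when `P` is admissible,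
every admissible piece other than `TOP` and (at `d = 4`) `P′` has codimension `≥ codim P`; (iii) for an admissible `σ ∈ {P′, Q_r, G_r}` every piece
of larger `r` (smaller `m`) has codimension `≥ codim σ`.  `…JumpFamilies.orderings_box` checks (i)–(iii) by `decide` for `4 ≤ k′ ≤ 8`, `4 ≤ d ≤ 10`;
this file kernel-checks, for ALL parameters (`d = e + 4`, `k′ = p + 4` unless stated), the binomial inequalities from which (i)–(iii) are assembled
in §4d together with `…JumpArithmetic` (admissibility, `BASE_G ≥ BASE_Q`, `BASE_Q(m-1) > BASE_G(m)`) and `…JumpFlag` (the values at `m ≤ 3`):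
* `baseQ_antitone`, `baseG_antitone` : `BASE_Q`, `BASE_G` are non-increasing in `m` on `m ≥ 3` [(iii), and the reductions below];
* `baseQ3_le_baseQ2`, `baseG3_le_baseQ2` : `BASE_Q(3), BASE_G(3) ≤ BASE_Q(2) = 6 - d` [(iii) against the `m = 2` pieces];
* `top_le_codim_Pprime`, `top_le_codim_P` : `codim TOP ≤ codim P′` and `codim TOP ≤ codim P` [(i); with `top_admissible` and the antitonicity];
* `P_le_Q` (`k′ ≥ 5`: `codim P ≤ codim Q_{2}`-side reduction `BASE_Q(k′-1) + k′ ≤ BASE_Q(k′-2) + 1`), `P_le_Qtwo` (`d ≥ 6`: `… ≤ BASE_Q(2) + 1`),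
  `P_le_Gtwo_d4` (`d = 4`: `… ≤ BASE_G(2) + 2`), `P_le_Pprime` (`d ≥ 5`: `… ≤ BASE_G(k′-1) + 1`) [(ii)].
NOT kernel-checked: the six-line assembly of (i)–(iii) from these inequalities (record §4d), and all geometry.
-/

namespace Summit.HodgeConjecture.HodgeConjecture.HodgeLocus.Census.JumpOrderings

/-- `BASE_Q` is non-increasing on `m ≥ 3` (`d = e + 4`): `3 ≤ m' ≤ m ⇒ BASE_Q(m) ≤ BASE_Q(m')`. -/
theorem baseQ_antitone (e : ℕ) : ∀ m m' : ℕ, 3 ≤ m' → m' ≤ m →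
    (m : ℤ) ^ 2 + ((Nat.choose (m + 1) 2 : ℕ) : ℤ) - ((Nat.choose (m + e + 3) (e + 4) : ℕ) : ℤ)
      ≤ (m' : ℤ) ^ 2 + ((Nat.choose (m' + 1) 2 : ℕ) : ℤ) - ((Nat.choose (m' + e + 3) (e + 4) : ℕ) : ℤ) := by
  -- one step: BASE_Q(p+4) ≤ BASE_Q(p+3)
  have step : ∀ p : ℕ, ((p : ℤ) + 4) ^ 2 + ((Nat.choose (p + 5) 2 : ℕ) : ℤ) - ((Nat.choose (p + e + 7) (e + 4) : ℕ) : ℤ)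
      ≤ ((p : ℤ) + 3) ^ 2 + ((Nat.choose (p + 4) 2 : ℕ) : ℤ) - ((Nat.choose (p + e + 6) (e + 4) : ℕ) : ℤ) := by
    intro p
    have pas1 : Nat.choose (p + e + 7) (e + 4) = Nat.choose (p + e + 6) (e + 3) + Nat.choose (p + e + 6) (e + 4) := by
      rw [show p + e + 7 = (p + e + 6) + 1 by ring, show e + 4 = (e + 3) + 1 by ring, Nat.choose_succ_succ]
    have pas2 : Nat.choose (p + 5) 2 = (p + 4) + Nat.choose (p + 4) 2 := by rw [show p + 5 = (p + 4) + 1 by ring, Nat.choose_succ_succ, Nat.choose_one_right]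
    have mono : Nat.choose (p + 6) 3 ≤ Nat.choose (p + e + 6) (e + 3) := by
      have s1 : Nat.choose (p + e + 6) (e + 3) = Nat.choose ((p + 3) + (e + 3)) (p + 3) := by rw [show p + e + 6 = (p + 3) + (e + 3) by ring, Nat.choose_symm_add]
      have s2 : Nat.choose (p + 6) 3 = Nat.choose ((p + 3) + 3) (p + 3) := by rw [show p + 6 = (p + 3) + 3 by ring, Nat.choose_symm_add]
      rw [s1, s2]; exact Nat.choose_mono (p + 3) (by omega)
    have grow3 : ∀ q : ℕ, 3 * q + 12 ≤ Nat.choose (q + 6) 3 := by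
      intro q
      induction q with
      | zero => decide
      | succ q ih =>
        rw [show q + 1 + 6 = q + 7 from rfl]
        have pas : Nat.choose (q + 7) 3 = Nat.choose (q + 6) 2 + Nat.choose (q + 6) 3 := by rw [show q + 7 = (q + 6) + 1 by ring, Nat.choose_succ_succ]
        have m2 : Nat.choose 6 2 ≤ Nat.choose (q + 6) 2 := Nat.choose_mono 2 (by omega)
        have c62 : Nat.choose 6 2 = 15 := by decide
        omega
    have g := grow3 p
    have sq : (p + 4) ^ 2 = (p + 3) ^ 2 + 2 * p + 7 := by ring
    have k' : (p + 4) ^ 2 + Nat.choose (p + 5) 2 + Nat.choose (p + e + 6) (e + 4)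
        ≤ (p + 3) ^ 2 + Nat.choose (p + 4) 2 + Nat.choose (p + e + 7) (e + 4) := by omega
    have kz : ((p : ℤ) + 4) ^ 2 + ((Nat.choose (p + 5) 2 : ℕ) : ℤ) + ((Nat.choose (p + e + 6) (e + 4) : ℕ) : ℤ)
        ≤ ((p : ℤ) + 3) ^ 2 + ((Nat.choose (p + 4) 2 : ℕ) : ℤ) + ((Nat.choose (p + e + 7) (e + 4) : ℕ) : ℤ) := by exact_mod_cast k'
    linarith
  intro m m' h3 hle
  induction m, hle using Nat.le_induction with
  | base => exact le_refl _
  | succ n hn ih =>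
    obtain ⟨p, rfl⟩ : ∃ p, n = p + 3 := ⟨n - 3, by omega⟩
    have s := step p
    rw [show p + 3 + 1 + 1 = p + 5 by ring, show p + 3 + 1 + e + 3 = p + e + 7 by ring, show p + 3 + 1 = p + 4 by ring]
    rw [show p + 3 + e + 3 = p + e + 6 by ring, show p + 3 + 1 = p + 4 by ring] at ih
    push_cast at ih ⊢
    linarith

/-- `BASE_G` is non-increasing on `m ≥ 3` (`d = e + 4`; `C(m+d-3, d-2) = C(m+e+1, e+2)`): `3 ≤ m' ≤ m ⇒ BASE_G(m) ≤ BASE_G(m')`. -/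
theorem baseG_antitone (e : ℕ) : ∀ m m' : ℕ, 3 ≤ m' → m' ≤ m →
    (m : ℤ) ^ 2 + ((Nat.choose (m + e + 1) (e + 2) : ℕ) : ℤ) - ((Nat.choose (m + e + 3) (e + 4) : ℕ) : ℤ)
      ≤ (m' : ℤ) ^ 2 + ((Nat.choose (m' + e + 1) (e + 2) : ℕ) : ℤ) - ((Nat.choose (m' + e + 3) (e + 4) : ℕ) : ℤ) := by
  have step : ∀ p : ℕ, ((p : ℤ) + 4) ^ 2 + ((Nat.choose (p + e + 5) (e + 2) : ℕ) : ℤ) - ((Nat.choose (p + e + 7) (e + 4) : ℕ) : ℤ)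
      ≤ ((p : ℤ) + 3) ^ 2 + ((Nat.choose (p + e + 4) (e + 2) : ℕ) : ℤ) - ((Nat.choose (p + e + 6) (e + 4) : ℕ) : ℤ) := by
    intro p
    have pas1 : Nat.choose (p + e + 7) (e + 4) = Nat.choose (p + e + 6) (e + 3) + Nat.choose (p + e + 6) (e + 4) := by
      rw [show p + e + 7 = (p + e + 6) + 1 by ring, show e + 4 = (e + 3) + 1 by ring, Nat.choose_succ_succ]
    have pas3 : Nat.choose (p + e + 5) (e + 2) = Nat.choose (p + e + 4) (e + 1) + Nat.choose (p + e + 4) (e + 2) := by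
      rw [show p + e + 5 = (p + e + 4) + 1 by ring, show e + 2 = (e + 1) + 1 by ring, Nat.choose_succ_succ]
    have pas4 : Nat.choose (p + e + 6) (e + 3) = Nat.choose (p + e + 5) (e + 2) + Nat.choose (p + e + 5) (e + 3) := by
      rw [show p + e + 6 = (p + e + 5) + 1 by ring, show e + 3 = (e + 2) + 1 by ring, Nat.choose_succ_succ]
    have monoA : Nat.choose (p + 4) 2 ≤ Nat.choose (p + e + 4) (e + 2) := by
      have s1 : Nat.choose (p + e + 4) (e + 2) = Nat.choose ((p + 2) + (e + 2)) (p + 2) := by rw [show p + e + 4 = (p + 2) + (e + 2) by ring, Nat.choose_symm_add]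
      have s2 : Nat.choose (p + 4) 2 = Nat.choose ((p + 2) + 2) (p + 2) := by rw [show p + 4 = (p + 2) + 2 by ring, Nat.choose_symm_add]
      rw [s1, s2]; exact Nat.choose_mono (p + 2) (by omega)
    have monoB : Nat.choose (p + 5) 3 ≤ Nat.choose (p + e + 5) (e + 3) := by
      have s1 : Nat.choose (p + e + 5) (e + 3) = Nat.choose ((p + 2) + (e + 3)) (p + 2) := by rw [show p + e + 5 = (p + 2) + (e + 3) by ring, Nat.choose_symm_add]
      have s2 : Nat.choose (p + 5) 3 = Nat.choose ((p + 2) + 3) (p + 2) := by rw [show p + 5 = (p + 2) + 3 by ring, Nat.choose_symm_add]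
      rw [s1, s2]; exact Nat.choose_mono (p + 2) (by omega)
    have grow2 : ∀ q : ℕ, 2 * q + 6 ≤ Nat.choose (q + 4) 2 := by
      intro q
      induction q with
      | zero => decide
      | succ q ih =>
        rw [show q + 1 + 4 = q + 5 from rfl]
        have pas : Nat.choose (q + 5) 2 = (q + 4) + Nat.choose (q + 4) 2 := by rw [show q + 5 = (q + 4) + 1 by ring, Nat.choose_succ_succ, Nat.choose_one_right]
        omega
    have g := grow2 p
    have c53 : Nat.choose 5 3 ≤ Nat.choose (p + 5) 3 := Nat.choose_mono 3 (by omega)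
    have c53' : Nat.choose 5 3 = 10 := by decide
    have sq : (p + 4) ^ 2 = (p + 3) ^ 2 + 2 * p + 7 := by ring
    have k' : (p + 4) ^ 2 + Nat.choose (p + e + 5) (e + 2) + Nat.choose (p + e + 6) (e + 4)
        ≤ (p + 3) ^ 2 + Nat.choose (p + e + 4) (e + 2) + Nat.choose (p + e + 7) (e + 4) := by omega
    have kz : ((p : ℤ) + 4) ^ 2 + ((Nat.choose (p + e + 5) (e + 2) : ℕ) : ℤ) + ((Nat.choose (p + e + 6) (e + 4) : ℕ) : ℤ)
        ≤ ((p : ℤ) + 3) ^ 2 + ((Nat.choose (p + e + 4) (e + 2) : ℕ) : ℤ) + ((Nat.choose (p + e + 7) (e + 4) : ℕ) : ℤ) := by exact_mod_cast k'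
    linarith
  intro m m' h3 hle
  induction m, hle using Nat.le_induction with
  | base => exact le_refl _
  | succ n hn ih =>
    obtain ⟨p, rfl⟩ : ∃ p, n = p + 3 := ⟨n - 3, by omega⟩
    have s := step p
    rw [show p + 3 + 1 + e + 1 = p + e + 5 by ring, show p + 3 + 1 + e + 3 = p + e + 7 by ring, show p + 3 + 1 = p + 4 by ring]
    rw [show p + 3 + e + 1 = p + e + 4 by ring, show p + 3 + e + 3 = p + e + 6 by ring] at ih
    push_cast at ih ⊢
    linarith

/-- `BASE_Q(3) ≤ BASE_Q(2)` (`= 6 - d`), `d = e + 4`: `9 + C(4,2) - C(e+6, e+4) ≤ 4 + C(3,2) - C(e+5, e+4)`. -/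
theorem baseQ3_le_baseQ2 (e : ℕ) :
    (3 : ℤ) ^ 2 + ((Nat.choose (3 + 1) 2 : ℕ) : ℤ) - ((Nat.choose (3 + e + 3) (e + 4) : ℕ) : ℤ)
      ≤ (2 : ℤ) ^ 2 + ((Nat.choose (2 + 1) 2 : ℕ) : ℤ) - ((Nat.choose (2 + e + 3) (e + 4) : ℕ) : ℤ) := by
  have a1 : 3 + e + 3 = e + 6 := by ring
  have a2 : 2 + e + 3 = e + 5 := by ring
  rw [a1, a2]
  have pas : Nat.choose (e + 6) (e + 4) = Nat.choose (e + 5) (e + 3) + Nat.choose (e + 5) (e + 4) := by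
    rw [show e + 6 = (e + 5) + 1 by ring, show e + 4 = (e + 3) + 1 by ring, Nat.choose_succ_succ]
  have mono : Nat.choose 5 2 ≤ Nat.choose (e + 5) (e + 3) := by
    have s1 : Nat.choose (e + 5) (e + 3) = Nat.choose (2 + (e + 3)) 2 := by rw [show e + 5 = 2 + (e + 3) by ring, Nat.choose_symm_add]
    have s2 : Nat.choose 5 2 = Nat.choose (2 + 3) 2 := by rfl
    rw [s1, s2]; exact Nat.choose_mono 2 (by omega)
  have c52 : Nat.choose 5 2 = 10 := by decide
  have c42 : Nat.choose (3 + 1) 2 = 6 := by decide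
  have c32 : Nat.choose (2 + 1) 2 = 3 := by decide
  have k' : 9 + Nat.choose (3 + 1) 2 + Nat.choose (e + 5) (e + 4) ≤ 4 + Nat.choose (2 + 1) 2 + Nat.choose (e + 6) (e + 4) := by omega
  have kz : (9 : ℤ) + ((Nat.choose (3 + 1) 2 : ℕ) : ℤ) + ((Nat.choose (e + 5) (e + 4) : ℕ) : ℤ)
      ≤ 4 + ((Nat.choose (2 + 1) 2 : ℕ) : ℤ) + ((Nat.choose (e + 6) (e + 4) : ℕ) : ℤ) := by exact_mod_cast k'
  linarith

/-- `BASE_G(3) ≤ BASE_Q(2)`, `d = e + 4`: `9 + C(e+4, e+2) - C(e+6, e+4) ≤ 4 + C(3,2) - C(e+5, e+4)` (i.e. `8 - 2d ≤ 6 - d`). -/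
theorem baseG3_le_baseQ2 (e : ℕ) :
    (3 : ℤ) ^ 2 + ((Nat.choose (3 + e + 1) (e + 2) : ℕ) : ℤ) - ((Nat.choose (3 + e + 3) (e + 4) : ℕ) : ℤ)
      ≤ (2 : ℤ) ^ 2 + ((Nat.choose (2 + 1) 2 : ℕ) : ℤ) - ((Nat.choose (2 + e + 3) (e + 4) : ℕ) : ℤ) := by
  have a0 : 3 + e + 1 = e + 4 := by ring
  have a1 : 3 + e + 3 = e + 6 := by ring
  have a2 : 2 + e + 3 = e + 5 := by ring
  rw [a0, a1, a2]
  have pas1 : Nat.choose (e + 6) (e + 4) = Nat.choose (e + 5) (e + 3) + Nat.choose (e + 5) (e + 4) := by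
    rw [show e + 6 = (e + 5) + 1 by ring, show e + 4 = (e + 3) + 1 by ring, Nat.choose_succ_succ]
  have pas2 : Nat.choose (e + 5) (e + 3) = Nat.choose (e + 4) (e + 2) + Nat.choose (e + 4) (e + 3) := by
    rw [show e + 5 = (e + 4) + 1 by ring, show e + 3 = (e + 2) + 1 by ring, Nat.choose_succ_succ]
  have cs : Nat.choose (e + 4) (e + 3) = e + 4 := by rw [show e + 4 = (e + 3) + 1 by ring, Nat.choose_succ_self_right]
  have c32 : Nat.choose (2 + 1) 2 = 3 := by decide
  have k' : 9 + Nat.choose (e + 4) (e + 2) + Nat.choose (e + 5) (e + 4) ≤ 4 + Nat.choose (2 + 1) 2 + Nat.choose (e + 6) (e + 4) := by omega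
  have kz : (9 : ℤ) + ((Nat.choose (e + 4) (e + 2) : ℕ) : ℤ) + ((Nat.choose (e + 5) (e + 4) : ℕ) : ℤ)
      ≤ 4 + ((Nat.choose (2 + 1) 2 : ℕ) : ℤ) + ((Nat.choose (e + 6) (e + 4) : ℕ) : ℤ) := by exact_mod_cast k'
  linarith

/-- `codim TOP ≤ codim P′` for all `k′ = p + 4`, `d = e + 4`:
`C(k′+d-3, d-2) ≤ (E+1) - 1 + BASE_G(k′-1) + 1`, written out. -/
theorem top_le_codim_Pprime (p e : ℕ) :
    ((Nat.choose (p + e + 5) (e + 2) : ℕ) : ℤ)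
      ≤ (((Nat.choose (p + e + 7) (e + 4) : ℕ) : ℤ) - ((Nat.choose (p + 5) 2 : ℕ) : ℤ) - ((p : ℤ) + 4) ^ 2 + 1) - 1
        + (((p : ℤ) + 3) ^ 2 + ((Nat.choose (p + e + 4) (e + 2) : ℕ) : ℤ) - ((Nat.choose (p + e + 6) (e + 4) : ℕ) : ℤ)) + 1 := by
  have pas1 : Nat.choose (p + e + 7) (e + 4) = Nat.choose (p + e + 6) (e + 3) + Nat.choose (p + e + 6) (e + 4) := by
    rw [show p + e + 7 = (p + e + 6) + 1 by ring, show e + 4 = (e + 3) + 1 by ring, Nat.choose_succ_succ]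
  have pas3 : Nat.choose (p + e + 5) (e + 2) = Nat.choose (p + e + 4) (e + 1) + Nat.choose (p + e + 4) (e + 2) := by
    rw [show p + e + 5 = (p + e + 4) + 1 by ring, show e + 2 = (e + 1) + 1 by ring, Nat.choose_succ_succ]
  have pas4 : Nat.choose (p + e + 6) (e + 3) = Nat.choose (p + e + 5) (e + 2) + Nat.choose (p + e + 5) (e + 3) := by
    rw [show p + e + 6 = (p + e + 5) + 1 by ring, show e + 3 = (e + 2) + 1 by ring, Nat.choose_succ_succ]
  have pas2 : Nat.choose (p + 5) 2 = (p + 4) + Nat.choose (p + 4) 2 := by rw [show p + 5 = (p + 4) + 1 by ring, Nat.choose_succ_succ, Nat.choose_one_right]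
  have monoA : Nat.choose (p + 4) 2 ≤ Nat.choose (p + e + 4) (e + 2) := by
    have s1 : Nat.choose (p + e + 4) (e + 2) = Nat.choose ((p + 2) + (e + 2)) (p + 2) := by rw [show p + e + 4 = (p + 2) + (e + 2) by ring, Nat.choose_symm_add]
    have s2 : Nat.choose (p + 4) 2 = Nat.choose ((p + 2) + 2) (p + 2) := by rw [show p + 4 = (p + 2) + 2 by ring, Nat.choose_symm_add]
    rw [s1, s2]; exact Nat.choose_mono (p + 2) (by omega)
  have monoB : Nat.choose (p + 5) 3 ≤ Nat.choose (p + e + 5) (e + 3) := by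
    have s1 : Nat.choose (p + e + 5) (e + 3) = Nat.choose ((p + 2) + (e + 3)) (p + 2) := by rw [show p + e + 5 = (p + 2) + (e + 3) by ring, Nat.choose_symm_add]
    have s2 : Nat.choose (p + 5) 3 = Nat.choose ((p + 2) + 3) (p + 2) := by rw [show p + 5 = (p + 2) + 3 by ring, Nat.choose_symm_add]
    rw [s1, s2]; exact Nat.choose_mono (p + 2) (by omega)
  have growC : ∀ q : ℕ, 3 * q + 10 ≤ Nat.choose (q + 5) 3 := by
    intro q
    induction q with
    | zero => decide
    | succ q ih =>
      rw [show q + 1 + 5 = q + 6 from rfl]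
      have pas : Nat.choose (q + 6) 3 = Nat.choose (q + 5) 2 + Nat.choose (q + 5) 3 := by rw [show q + 6 = (q + 5) + 1 by ring, Nat.choose_succ_succ]
      have m2 : Nat.choose 5 2 ≤ Nat.choose (q + 5) 2 := Nat.choose_mono 2 (by omega)
      have c52 : Nat.choose 5 2 = 10 := by decide
      omega
  have g := growC p
  have sq : (p + 4) ^ 2 = (p + 3) ^ 2 + 2 * p + 7 := by ring
  have k' : Nat.choose (p + e + 5) (e + 2) + Nat.choose (p + 5) 2 + (p + 4) ^ 2 + Nat.choose (p + e + 6) (e + 4)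
      ≤ Nat.choose (p + e + 7) (e + 4) + (p + 3) ^ 2 + Nat.choose (p + e + 4) (e + 2) + 1 := by omega
  have kz : ((Nat.choose (p + e + 5) (e + 2) : ℕ) : ℤ) + ((Nat.choose (p + 5) 2 : ℕ) : ℤ) + ((p : ℤ) + 4) ^ 2
        + ((Nat.choose (p + e + 6) (e + 4) : ℕ) : ℤ)
      ≤ ((Nat.choose (p + e + 7) (e + 4) : ℕ) : ℤ) + ((p : ℤ) + 3) ^ 2 + ((Nat.choose (p + e + 4) (e + 2) : ℕ) : ℤ) + 1 := by exact_mod_cast k'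
  linarith

/-- `codim TOP ≤ codim P` for all `k′ = p + 4`, `d = e + 4`:
`C(k′+d-3, d-2) ≤ (E+1) - 1 + BASE_Q(k′-1) + k′`, written out. -/
theorem top_le_codim_P (p e : ℕ) :
    ((Nat.choose (p + e + 5) (e + 2) : ℕ) : ℤ)
      ≤ (((Nat.choose (p + e + 7) (e + 4) : ℕ) : ℤ) - ((Nat.choose (p + 5) 2 : ℕ) : ℤ) - ((p : ℤ) + 4) ^ 2 + 1) - 1
        + (((p : ℤ) + 3) ^ 2 + ((Nat.choose (p + 4) 2 : ℕ) : ℤ) - ((Nat.choose (p + e + 6) (e + 4) : ℕ) : ℤ)) + ((p : ℤ) + 4) := by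
  have pas1 : Nat.choose (p + e + 7) (e + 4) = Nat.choose (p + e + 6) (e + 3) + Nat.choose (p + e + 6) (e + 4) := by
    rw [show p + e + 7 = (p + e + 6) + 1 by ring, show e + 4 = (e + 3) + 1 by ring, Nat.choose_succ_succ]
  have pas4 : Nat.choose (p + e + 6) (e + 3) = Nat.choose (p + e + 5) (e + 2) + Nat.choose (p + e + 5) (e + 3) := by
    rw [show p + e + 6 = (p + e + 5) + 1 by ring, show e + 3 = (e + 2) + 1 by ring, Nat.choose_succ_succ]
  have pas2 : Nat.choose (p + 5) 2 = (p + 4) + Nat.choose (p + 4) 2 := by rw [show p + 5 = (p + 4) + 1 by ring, Nat.choose_succ_succ, Nat.choose_one_right]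
  have monoB : Nat.choose (p + 5) 3 ≤ Nat.choose (p + e + 5) (e + 3) := by
    have s1 : Nat.choose (p + e + 5) (e + 3) = Nat.choose ((p + 2) + (e + 3)) (p + 2) := by rw [show p + e + 5 = (p + 2) + (e + 3) by ring, Nat.choose_symm_add]
    have s2 : Nat.choose (p + 5) 3 = Nat.choose ((p + 2) + 3) (p + 2) := by rw [show p + 5 = (p + 2) + 3 by ring, Nat.choose_symm_add]
    rw [s1, s2]; exact Nat.choose_mono (p + 2) (by omega)
  have growC : ∀ q : ℕ, 3 * q + 10 ≤ Nat.choose (q + 5) 3 := by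
    intro q
    induction q with
    | zero => decide
    | succ q ih =>
      rw [show q + 1 + 5 = q + 6 from rfl]
      have pas : Nat.choose (q + 6) 3 = Nat.choose (q + 5) 2 + Nat.choose (q + 5) 3 := by rw [show q + 6 = (q + 5) + 1 by ring, Nat.choose_succ_succ]
      have m2 : Nat.choose 5 2 ≤ Nat.choose (q + 5) 2 := Nat.choose_mono 2 (by omega)
      have c52 : Nat.choose 5 2 = 10 := by decide
      omega
  have g := growC p
  have sq : (p + 4) ^ 2 = (p + 3) ^ 2 + 2 * p + 7 := by ring
  have k' : Nat.choose (p + e + 5) (e + 2) + Nat.choose (p + 5) 2 + (p + 4) ^ 2 + Nat.choose (p + e + 6) (e + 4)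
      ≤ Nat.choose (p + e + 7) (e + 4) + (p + 3) ^ 2 + Nat.choose (p + 4) 2 + (p + 4) := by omega
  have kz : ((Nat.choose (p + e + 5) (e + 2) : ℕ) : ℤ) + ((Nat.choose (p + 5) 2 : ℕ) : ℤ) + ((p : ℤ) + 4) ^ 2
        + ((Nat.choose (p + e + 6) (e + 4) : ℕ) : ℤ)
      ≤ ((Nat.choose (p + e + 7) (e + 4) : ℕ) : ℤ) + ((p : ℤ) + 3) ^ 2 + ((Nat.choose (p + 4) 2 : ℕ) : ℤ) + ((p : ℤ) + 4) := by exact_mod_cast k'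
  linarith

/-- (ii), `Q`-branch reduction, `k′ = q + 5 ≥ 5`, `d = e + 4`: `BASE_Q(k′-1) + k′ ≤ BASE_Q(k′-2) + 1`, i.e.
`(q+4)² + C(q+5,2) - C(q+e+7, e+4) + (q+5) ≤ (q+3)² + C(q+4,2) - C(q+e+6, e+4) + 1`. -/
theorem P_le_Q (q e : ℕ) :
    ((q : ℤ) + 4) ^ 2 + ((Nat.choose (q + 5) 2 : ℕ) : ℤ) - ((Nat.choose (q + e + 7) (e + 4) : ℕ) : ℤ) + ((q : ℤ) + 5)
      ≤ ((q : ℤ) + 3) ^ 2 + ((Nat.choose (q + 4) 2 : ℕ) : ℤ) - ((Nat.choose (q + e + 6) (e + 4) : ℕ) : ℤ) + 1 := by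
  have pas1 : Nat.choose (q + e + 7) (e + 4) = Nat.choose (q + e + 6) (e + 3) + Nat.choose (q + e + 6) (e + 4) := by
    rw [show q + e + 7 = (q + e + 6) + 1 by ring, show e + 4 = (e + 3) + 1 by ring, Nat.choose_succ_succ]
  have pas2 : Nat.choose (q + 5) 2 = (q + 4) + Nat.choose (q + 4) 2 := by rw [show q + 5 = (q + 4) + 1 by ring, Nat.choose_succ_succ, Nat.choose_one_right]
  have mono : Nat.choose (q + 6) 3 ≤ Nat.choose (q + e + 6) (e + 3) := by
    have s1 : Nat.choose (q + e + 6) (e + 3) = Nat.choose ((q + 3) + (e + 3)) (q + 3) := by rw [show q + e + 6 = (q + 3) + (e + 3) by ring, Nat.choose_symm_add]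
    have s2 : Nat.choose (q + 6) 3 = Nat.choose ((q + 3) + 3) (q + 3) := by rw [show q + 6 = (q + 3) + 3 by ring, Nat.choose_symm_add]
    rw [s1, s2]; exact Nat.choose_mono (q + 3) (by omega)
  have grow4 : ∀ n : ℕ, 4 * n + 15 ≤ Nat.choose (n + 6) 3 := by
    intro n
    induction n with
    | zero => decide
    | succ n ih =>
      rw [show n + 1 + 6 = n + 7 from rfl]
      have pas : Nat.choose (n + 7) 3 = Nat.choose (n + 6) 2 + Nat.choose (n + 6) 3 := by rw [show n + 7 = (n + 6) + 1 by ring, Nat.choose_succ_succ]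
      have m2 : Nat.choose 6 2 ≤ Nat.choose (n + 6) 2 := Nat.choose_mono 2 (by omega)
      have c62 : Nat.choose 6 2 = 15 := by decide
      omega
  have g := grow4 q
  have sq : (q + 4) ^ 2 = (q + 3) ^ 2 + 2 * q + 7 := by ring
  have k' : (q + 4) ^ 2 + Nat.choose (q + 5) 2 + (q + 5) + Nat.choose (q + e + 6) (e + 4)
      ≤ (q + 3) ^ 2 + Nat.choose (q + 4) 2 + Nat.choose (q + e + 7) (e + 4) + 1 := by omega
  have kz : ((q : ℤ) + 4) ^ 2 + ((Nat.choose (q + 5) 2 : ℕ) : ℤ) + ((q : ℤ) + 5) + ((Nat.choose (q + e + 6) (e + 4) : ℕ) : ℤ)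
      ≤ ((q : ℤ) + 3) ^ 2 + ((Nat.choose (q + 4) 2 : ℕ) : ℤ) + ((Nat.choose (q + e + 7) (e + 4) : ℕ) : ℤ) + 1 := by exact_mod_cast k'
  linarith

/-- (ii) against `Q_{k′-2}` (`m = 2`, admissible only for `d ≥ 6`), `k′ = p + 4`, `d = f + 6`:
`BASE_Q(k′-1) + k′ ≤ BASE_Q(2) + 1`, i.e. `(p+3)² + C(p+4,2) - C(p+f+8, f+6) + (p+4) ≤ 2² + C(3,2) - C(f+7, f+6) + 1`. -/
theorem P_le_Qtwo (p f : ℕ) :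
    ((p : ℤ) + 3) ^ 2 + ((Nat.choose (p + 4) 2 : ℕ) : ℤ) - ((Nat.choose (p + f + 8) (f + 6) : ℕ) : ℤ) + ((p : ℤ) + 4)
      ≤ (2 : ℤ) ^ 2 + ((Nat.choose (2 + 1) 2 : ℕ) : ℤ) - ((Nat.choose (2 + (f + 6) - 1) (f + 6) : ℕ) : ℤ) + 1 := by
  have a1 : 2 + (f + 6) - 1 = f + 7 := by omega
  rw [a1]
  have cs : Nat.choose (f + 7) (f + 6) = f + 7 := by rw [show f + 7 = (f + 6) + 1 by ring, Nat.choose_succ_self_right]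
  have c32 : Nat.choose (2 + 1) 2 = 3 := by decide
  have grow3 : ∀ q : ℕ, 3 * q + 12 ≤ Nat.choose (q + 6) 3 := by
    intro q
    induction q with
    | zero => decide
    | succ q ih =>
      rw [show q + 1 + 6 = q + 7 from rfl]
      have pas : Nat.choose (q + 7) 3 = Nat.choose (q + 6) 2 + Nat.choose (q + 6) 3 := by rw [show q + 7 = (q + 6) + 1 by ring, Nat.choose_succ_succ]
      have m2 : Nat.choose 6 2 ≤ Nat.choose (q + 6) 2 := Nat.choose_mono 2 (by omega)
      have c62 : Nat.choose 6 2 = 15 := by decide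
      omega
  -- f = 0: (q+3)² + C(q+4,2) + q + 3 ≤ C(q+8, 6), by induction on q
  have base : ∀ q : ℕ, (q + 3) ^ 2 + Nat.choose (q + 4) 2 + q + 3 ≤ Nat.choose (q + 8) 6 := by
    intro q
    induction q with
    | zero => decide
    | succ q ih =>
      rw [show q + 1 + 3 = q + 4 from rfl, show q + 1 + 4 = q + 5 from rfl, show q + 1 + 8 = q + 9 from rfl]
      have r1 : Nat.choose (q + 9) 6 = Nat.choose (q + 8) 5 + Nat.choose (q + 8) 6 := by rw [show q + 9 = (q + 8) + 1 by ring, Nat.choose_succ_succ]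
      have r2 : Nat.choose (q + 5) 2 = (q + 4) + Nat.choose (q + 4) 2 := by rw [show q + 5 = (q + 4) + 1 by ring, Nat.choose_succ_succ, Nat.choose_one_right]
      have mono : Nat.choose (q + 6) 3 ≤ Nat.choose (q + 8) 5 := by
        have s1 : Nat.choose (q + 8) 5 = Nat.choose ((q + 3) + 5) (q + 3) := by rw [show q + 8 = (q + 3) + 5 by ring, Nat.choose_symm_add]
        have s2 : Nat.choose (q + 6) 3 = Nat.choose ((q + 3) + 3) (q + 3) := by rw [show q + 6 = (q + 3) + 3 by ring, Nat.choose_symm_add]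
        rw [s1, s2]; exact Nat.choose_mono (q + 3) (by omega)
      have sq : (q + 4) ^ 2 = (q + 3) ^ 2 + 2 * q + 7 := by ring
      have g := grow3 q
      omega
  have key : ∀ g' : ℕ, (p + 3) ^ 2 + Nat.choose (p + 4) 2 + p + g' + 3 ≤ Nat.choose (p + g' + 8) (g' + 6) := by
    intro g'
    induction g' with
    | zero =>
      rw [show p + 0 + 8 = p + 8 from rfl, show (0 : ℕ) + 6 = 6 from rfl]
      have b := base p
      omega
    | succ g' ih =>
      have pas : Nat.choose (p + (g' + 1) + 8) (g' + 1 + 6) = Nat.choose (p + g' + 8) (g' + 6) + Nat.choose (p + g' + 8) (g' + 6 + 1) := by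
        rw [show p + (g' + 1) + 8 = (p + g' + 8) + 1 by ring, show g' + 1 + 6 = (g' + 6) + 1 by ring, Nat.choose_succ_succ]
      have pos : 0 < Nat.choose (p + g' + 8) (g' + 6 + 1) := Nat.choose_pos (by omega)
      omega
  have k := key f
  have k' : (p + 3) ^ 2 + Nat.choose (p + 4) 2 + (p + 4) + Nat.choose (f + 7) (f + 6)
      ≤ 4 + Nat.choose (2 + 1) 2 + 1 + Nat.choose (p + f + 8) (f + 6) := by omega
  have kz : ((p : ℤ) + 3) ^ 2 + ((Nat.choose (p + 4) 2 : ℕ) : ℤ) + ((p : ℤ) + 4) + ((Nat.choose (f + 7) (f + 6) : ℕ) : ℤ)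
      ≤ 4 + ((Nat.choose (2 + 1) 2 : ℕ) : ℤ) + 1 + ((Nat.choose (p + f + 8) (f + 6) : ℕ) : ℤ) := by exact_mod_cast k'
  linarith

/-- (ii) against `G_2` at `d = 4` (`m = k′-2`, `φ = 2`), `k′ = p + 4`: `BASE_Q(k′-1) + k′ ≤ BASE_G(2) + 2`, i.e.
`(p+3)² + C(p+4,2) - C(p+6,4) + (p+4) ≤ 2² + C(3,2) - C(5,4) + 2`. -/
theorem P_le_Gtwo_d4 (p : ℕ) :
    ((p : ℤ) + 3) ^ 2 + ((Nat.choose (p + 4) 2 : ℕ) : ℤ) - ((Nat.choose (p + 6) 4 : ℕ) : ℤ) + ((p : ℤ) + 4)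
      ≤ (2 : ℤ) ^ 2 + ((Nat.choose (2 + 4 - 3) (4 - 2) : ℕ) : ℤ) - ((Nat.choose (2 + 4 - 1) 4 : ℕ) : ℤ) + 2 := by
  have c1 : Nat.choose (2 + 4 - 3) (4 - 2) = 3 := by decide
  have c2 : Nat.choose (2 + 4 - 1) 4 = 5 := by decide
  have grow3 : ∀ q : ℕ, 3 * q + 12 ≤ Nat.choose (q + 6) 3 := by
    intro q
    induction q with
    | zero => decide
    | succ q ih =>
      rw [show q + 1 + 6 = q + 7 from rfl]
      have pas : Nat.choose (q + 7) 3 = Nat.choose (q + 6) 2 + Nat.choose (q + 6) 3 := by rw [show q + 7 = (q + 6) + 1 by ring, Nat.choose_succ_succ]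
      have m2 : Nat.choose 6 2 ≤ Nat.choose (q + 6) 2 := Nat.choose_mono 2 (by omega)
      have c62 : Nat.choose 6 2 = 15 := by decide
      omega
  have key : ∀ q : ℕ, (q + 3) ^ 2 + Nat.choose (q + 4) 2 + q ≤ Nat.choose (q + 6) 4 := by
    intro q
    induction q with
    | zero => decide
    | succ q ih =>
      rw [show q + 1 + 3 = q + 4 from rfl, show q + 1 + 4 = q + 5 from rfl, show q + 1 + 6 = q + 7 from rfl]
      have r1 : Nat.choose (q + 7) 4 = Nat.choose (q + 6) 3 + Nat.choose (q + 6) 4 := by rw [show q + 7 = (q + 6) + 1 by ring, Nat.choose_succ_succ]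
      have r2 : Nat.choose (q + 5) 2 = (q + 4) + Nat.choose (q + 4) 2 := by rw [show q + 5 = (q + 4) + 1 by ring, Nat.choose_succ_succ, Nat.choose_one_right]
      have sq : (q + 4) ^ 2 = (q + 3) ^ 2 + 2 * q + 7 := by ring
      have g := grow3 q
      omega
  have k := key p
  have k' : (p + 3) ^ 2 + Nat.choose (p + 4) 2 + (p + 4) + Nat.choose (2 + 4 - 1) 4
      ≤ 4 + Nat.choose (2 + 4 - 3) (4 - 2) + 2 + Nat.choose (p + 6) 4 := by omega
  have kz : ((p : ℤ) + 3) ^ 2 + ((Nat.choose (p + 4) 2 : ℕ) : ℤ) + ((p : ℤ) + 4) + ((Nat.choose (2 + 4 - 1) 4 : ℕ) : ℤ)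
      ≤ 4 + ((Nat.choose (2 + 4 - 3) (4 - 2) : ℕ) : ℤ) + 2 + ((Nat.choose (p + 6) 4 : ℕ) : ℤ) := by exact_mod_cast k'
  linarith

/-- (ii) against `P′` for `d ≥ 5` (`k′ = p + 4`, `d = f + 5`): `BASE_Q(k′-1) + k′ ≤ BASE_G(k′-1) + 1`, i.e.
`(p+3)² + C(p+4,2) - C(p+f+7, f+5) + (p+4) ≤ (p+3)² + C(p+f+5, f+3) - C(p+f+7, f+5) + 1`. -/
theorem P_le_Pprime (p f : ℕ) :
    ((p : ℤ) + 3) ^ 2 + ((Nat.choose (p + 4) 2 : ℕ) : ℤ) - ((Nat.choose (p + f + 7) (f + 5) : ℕ) : ℤ) + ((p : ℤ) + 4)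
      ≤ ((p : ℤ) + 3) ^ 2 + ((Nat.choose ((p + 3) + (f + 5) - 3) ((f + 5) - 2) : ℕ) : ℤ)
          - ((Nat.choose (p + f + 7) (f + 5) : ℕ) : ℤ) + 1 := by
  have a1 : (p + 3) + (f + 5) - 3 = p + f + 5 := by omega
  have a2 : (f + 5) - 2 = f + 3 := by omega
  rw [a1, a2]
  have mono : Nat.choose (p + 5) 3 ≤ Nat.choose (p + f + 5) (f + 3) := by
    have s1 : Nat.choose (p + f + 5) (f + 3) = Nat.choose ((p + 2) + (f + 3)) (p + 2) := by rw [show p + f + 5 = (p + 2) + (f + 3) by ring, Nat.choose_symm_add]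
    have s2 : Nat.choose (p + 5) 3 = Nat.choose ((p + 2) + 3) (p + 2) := by rw [show p + 5 = (p + 2) + 3 by ring, Nat.choose_symm_add]
    rw [s1, s2]; exact Nat.choose_mono (p + 2) (by omega)
  have pas : Nat.choose (p + 5) 3 = Nat.choose (p + 4) 2 + Nat.choose (p + 4) 3 := by rw [show p + 5 = (p + 4) + 1 by ring, Nat.choose_succ_succ]
  have grow : ∀ q : ℕ, 2 * q + 4 ≤ Nat.choose (q + 4) 3 := by
    intro q
    induction q with
    | zero => decide
    | succ q ih =>
      rw [show q + 1 + 4 = q + 5 from rfl]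
      have pas' : Nat.choose (q + 5) 3 = Nat.choose (q + 4) 2 + Nat.choose (q + 4) 3 := by rw [show q + 5 = (q + 4) + 1 by ring, Nat.choose_succ_succ]
      have m2 : Nat.choose 4 2 ≤ Nat.choose (q + 4) 2 := Nat.choose_mono 2 (by omega)
      have c42 : Nat.choose 4 2 = 6 := by decide
      omega
  have g := grow p
  have k' : Nat.choose (p + 4) 2 + (p + 4) ≤ Nat.choose (p + f + 5) (f + 3) + 1 := by omega
  have kz : ((Nat.choose (p + 4) 2 : ℕ) : ℤ) + ((p : ℤ) + 4) ≤ ((Nat.choose (p + f + 5) (f + 3) : ℕ) : ℤ) + 1 := by exact_mod_cast k'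
  linarith

end Summit.HodgeConjecture.HodgeConjecture.HodgeLocus.Census.JumpOrderings
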